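import Mathlib
import Literature.NumberTheory.Transcendental.KZCalculus
import Summits.KontsevichZagierPeriods.KontsevichZagierPeriods.Theses.UnfoldedStokes

/-!
# `HyperellipticRiemannRelation` (stmt-KontsevichZagierPeriods-3522), line `SketchIdeator2` —
# stub `stub_kernelIntegrable`: auxiliary file (weights, null sets, the `K′` bound)

Absolute integrability of the two bulk integrands of the fibred half-plane transport on the open
prisms: `B = Re K′/(1−σ)²` (simplex kernel, prism `{u > 0} × ℝ × (0,1)`) and
`B₁ = −ρ(x₀) Im k′/(1−σ)²` (spectator kernel, prism `J_L × ℝ × (0,1)`). Both are dominated, off a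
null set of branch lines, by a product `c · h(σ) · P(w₀, w₁)` of an integrable one-variable height
weight `h(σ) = ν(σ/(1−σ))/(1−σ)²` (`ν` from `stub_bounds`, transported along `s = σ/(1−σ)`) and an
integrable planar weight `P` (`m(τ−u) m(τ)` resp. `m(a) m(τ)`, `m` from `stub_bounds`; Tonelli and
the measure-preserving shear `(u,τ) ↦ (u−τ, τ)`), and such products are integrable on `ℝ³`
(transport along `ℝ³ ≃ ℝ × ℝ²`). The pointwise kernel bounds are the HYPOTHESIS supplied by
`stub_bounds`; nothing here is specific to square roots beyond `‖√w‖ = √‖w‖`.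

References: Kontsevich–Zagier 2001 §1.1 (absolute convergence is part of the data of a period);
folklore real analysis.
-/

noncomputable section

namespace Summit.KontsevichZagierPeriods.UnfoldedStokes.HyperellipticRiemannRelationLine

open Set MeasureTheory Filter Topology
open Literature.NumberTheory.Transcendental
open Literature.ModelTheory.ExponentialFields (IsSemialgebraic)

namespace KernelIntegrable

/-! ## Products of integrable weights are integrable on `ℝ³` -/

/-- Transport along `ℝ³ ≃ ℝ × ℝ²`, `w ↦ (w 2, (w 0, w 1))` (measure preserving): a product
`h(w 2) · P(w 0, w 1)` of an integrable function on `ℝ` and an integrable function on `ℝ²` is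
integrable on `ℝ³` (Tonelli). [folklore] -/
theorem integrable_fin3_of_prod {h : ℝ → ℝ} {P : ℝ × ℝ → ℝ} (hh : Integrable h)
    (hP : Integrable P) : Integrable (fun w : Fin 3 → ℝ => h (w 2) * P (w 0, w 1)) := by
  have hE : MeasurePreserving
      ((Prod.map id (MeasurableEquiv.finTwoArrow : (Fin 2 → ℝ) → ℝ × ℝ)) ∘
        (MeasurableEquiv.piFinSuccAbove (fun _ : Fin 3 => ℝ) (Fin.last 2)))
      (volume : Measure (Fin 3 → ℝ)) (volume : Measure (ℝ × (ℝ × ℝ))) :=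
    ((MeasurePreserving.id volume).prod (volume_preserving_finTwoArrow ℝ)).comp
      (volume_preserving_piFinSuccAbove (fun _ : Fin 3 => ℝ) (Fin.last 2))
  have hg : Integrable (fun p : ℝ × (ℝ × ℝ) => h p.1 * P p.2) (volume : Measure (ℝ × (ℝ × ℝ))) :=
    hh.mul_prod hP
  have hcomp := hE.integrable_comp_of_integrable hg
  refine hcomp.congr (Eventually.of_forall fun w => ?_)
  have h2 : (Fin.last 2 : Fin 3) = 2 := rfl
  simp [MeasurableEquiv.piFinSuccAbove, MeasurableEquiv.finTwoArrow, Fin.removeNth, h2]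
  left
  have h1 : Fin.succAbove (2 : Fin 3) (1 : Fin 2) = 1 := by decide
  rw [h1]

/-- The sheared product `m(τ − u) · m(τ)` of an integrable `m` is integrable on `ℝ²`
(`(u,τ) ↦ (u − τ, τ)` preserves Lebesgue measure; `m(τ−u) = (m ∘ neg)(u − τ)`). [folklore] -/
theorem integrable_shear {m : ℝ → ℝ} (hm : Integrable m) :
    Integrable (fun p : ℝ × ℝ => m (p.2 - p.1) * m p.2) := by
  have h1 : Integrable (fun q : ℝ × ℝ => m (-q.1) * m q.2) ((volume : Measure ℝ).prod volume) :=
    hm.comp_neg.mul_prod hm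
  have h2 := (measurePreserving_sub_prod (volume : Measure ℝ) (volume : Measure ℝ))
    |>.integrable_comp_of_integrable h1
  rw [← Measure.volume_eq_prod] at h2
  refine h2.congr (Eventually.of_forall fun p => ?_)
  simp [Function.comp, neg_sub]

/-- The plain product `m(a) · m(τ)` of an integrable `m` is integrable on `ℝ²` (Tonelli). [folklore] -/
theorem integrable_prod {m : ℝ → ℝ} (hm : Integrable m) :
    Integrable (fun p : ℝ × ℝ => m p.1 * m p.2) := by
  have h := hm.mul_prod hm
  rwa [← Measure.volume_eq_prod] at h

/-! ## The height substitution `s = σ/(1−σ)` -/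

/-- A weight integrable on `(0, ∞)` pulled back along `s = σ/(1−σ)` (with its Jacobian `(1−σ)⁻²`)
is integrable on `(0, 1)` (one-dimensional change of variables). [folklore] -/
theorem integrableOn_height {ν : ℝ → ℝ} (hν : IntegrableOn ν (Ioi 0)) :
    IntegrableOn (fun σ : ℝ => 1 / (1 - σ) ^ 2 * ν (σ / (1 - σ))) (Ioo 0 1) := by
  have hderiv : ∀ σ ∈ Ioo (0:ℝ) 1,
      HasDerivWithinAt (fun σ : ℝ => σ / (1 - σ)) (1 / (1 - σ) ^ 2) (Ioo 0 1) σ := by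
    intro σ hσ
    have h1 : (1 - σ) ≠ 0 := (sub_pos.2 hσ.2).ne'
    have hd : HasDerivAt (fun x : ℝ => x / (1 - x)) ((1 * (1 - σ) - σ * (0 - 1)) / (1 - σ) ^ 2) σ :=
      (hasDerivAt_id' σ).div ((hasDerivAt_const σ (1:ℝ)).sub (hasDerivAt_id' σ)) h1
    have heq : (1 * (1 - σ) - σ * (0 - 1)) / (1 - σ) ^ 2 = 1 / (1 - σ) ^ 2 := by
      field_simp
      ring
    exact (hd.congr_deriv heq).hasDerivWithinAt
  have hinj : InjOn (fun σ : ℝ => σ / (1 - σ)) (Ioo 0 1) := by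
    intro a ha b hb hab
    have ha1 : (1 - a) ≠ 0 := (sub_pos.2 ha.2).ne'
    have hb1 : (1 - b) ≠ 0 := (sub_pos.2 hb.2).ne'
    have h : a * (1 - b) = b * (1 - a) := by
      have := hab
      field_simp at this
      linarith
    nlinarith
  have himage : (fun σ : ℝ => σ / (1 - σ)) '' Ioo 0 1 = Ioi 0 := by
    ext y
    simp only [mem_image, mem_Ioo, mem_Ioi]
    constructor
    · rintro ⟨σ, ⟨h0, h1⟩, rfl⟩
      exact div_pos h0 (sub_pos.2 h1)
    · intro hy
      refine ⟨y / (1 + y), ⟨div_pos hy (by linarith), (div_lt_one (by linarith)).2 (by linarith)⟩,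
        ?_⟩
      have h1 : (1 + y) ≠ 0 := by positivity
      field_simp
      ring
  have h := (integrableOn_image_iff_integrableOn_abs_deriv_smul measurableSet_Ioo hderiv hinj ν).1
    (himage ▸ hν)
  refine h.congr_fun (fun σ hσ => ?_) measurableSet_Ioo
  have hpos : 0 < 1 / (1 - σ) ^ 2 := by
    have : 0 < 1 - σ := sub_pos.2 hσ.2
    positivity
  show |1 / (1 - σ) ^ 2| • ν (σ / (1 - σ)) = 1 / (1 - σ) ^ 2 * ν (σ / (1 - σ))
  rw [abs_of_pos hpos, smul_eq_mul]

/-- The height weight as an integrable function on `ℝ` (indicator of `(0,1)`). [folklore] -/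
theorem integrable_heightIndicator {ν : ℝ → ℝ} (hν : IntegrableOn ν (Ioi 0)) :
    Integrable ((Ioo (0:ℝ) 1).indicator (fun σ : ℝ => 1 / (1 - σ) ^ 2 * ν (σ / (1 - σ)))) :=
  (integrableOn_height hν).integrable_indicator measurableSet_Ioo

/-! ## Null sets of branch lines in `ℝ³` -/

/-- A coordinate hyperplane `{w | w i = c}` of `ℝ³` is Lebesgue-null. [folklore] -/
theorem volume_coord_eq (i : Fin 3) (c : ℝ) : volume {w : Fin 3 → ℝ | w i = c} = 0 := by
  rw [volume_pi]
  exact Measure.pi_hyperplane _ _ _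

/-- The diagonal hyperplane `{w | w 1 − w 0 = c}` of `ℝ³` is Lebesgue-null (a proper affine
subspace). [folklore] -/
theorem volume_diag_eq (c : ℝ) : volume {w : Fin 3 → ℝ | w 1 - w 0 = c} = 0 := by
  let ℓ : (Fin 3 → ℝ) →ₗ[ℝ] ℝ :=
    LinearMap.proj (R := ℝ) (ι := Fin 3) (φ := fun _ => ℝ) 1 -
      LinearMap.proj (R := ℝ) (ι := Fin 3) (φ := fun _ => ℝ) 0
  let p₀ : Fin 3 → ℝ := Pi.single 1 c
  let S : AffineSubspace ℝ (Fin 3 → ℝ) := AffineSubspace.mk' p₀ (LinearMap.ker ℓ)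
  have hS : (S : Set (Fin 3 → ℝ)) = {w | w 1 - w 0 = c} := by
    ext w
    simp only [SetLike.mem_coe, AffineSubspace.mem_mk', vsub_eq_sub, LinearMap.mem_ker,
      LinearMap.sub_apply, LinearMap.coe_proj, Function.eval, Pi.sub_apply, mem_setOf_eq, S, ℓ,
      p₀]
    simp
    constructor <;> intro h <;> linarith
  have hne : S ≠ ⊤ := by
    intro h
    have huniv := (AffineSubspace.coe_eq_univ_iff S).2 h
    rw [hS] at huniv
    have hmem : (Pi.single 1 (c + 1) : Fin 3 → ℝ) ∈ {w : Fin 3 → ℝ | w 1 - w 0 = c} :=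
      huniv ▸ mem_univ _
    simp at hmem
  rw [← hS]
  exact Measure.addHaar_affineSubspace volume S hne

/-- The branch lines of the simplex kernel, `{w 1 = eⱼ} ∪ {w 1 − w 0 = eⱼ}`, form a null set. -/
theorem volume_badSimplex (e : Fin 5 → ℚ) :
    volume {w : Fin 3 → ℝ | ∃ j, w 1 = (e j : ℝ) ∨ w 1 - w 0 = (e j : ℝ)} = 0 := by
  have : {w : Fin 3 → ℝ | ∃ j, w 1 = (e j : ℝ) ∨ w 1 - w 0 = (e j : ℝ)} =
      ⋃ j : Fin 5, ({w : Fin 3 → ℝ | w 1 = (e j : ℝ)} ∪ {w | w 1 - w 0 = (e j : ℝ)}) := by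
    ext w
    simp only [mem_setOf_eq, mem_iUnion, mem_union]
  rw [this]
  exact measure_iUnion_null fun j =>
    measure_union_null (volume_coord_eq 1 _) (volume_diag_eq _)

/-- The branch lines of the spectator kernel, `{w 0 = eⱼ} ∪ {w 1 = eⱼ}`, form a null set. -/
theorem volume_badSpectator (e : Fin 5 → ℚ) :
    volume {w : Fin 3 → ℝ | ∃ j, w 0 = (e j : ℝ) ∨ w 1 = (e j : ℝ)} = 0 := by
  have : {w : Fin 3 → ℝ | ∃ j, w 0 = (e j : ℝ) ∨ w 1 = (e j : ℝ)} =
      ⋃ j : Fin 5, ({w : Fin 3 → ℝ | w 0 = (e j : ℝ)} ∪ {w | w 1 = (e j : ℝ)}) := by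
    ext w
    simp only [mem_setOf_eq, mem_iUnion, mem_union]
  rw [this]
  exact measure_iUnion_null fun j =>
    measure_union_null (volume_coord_eq 0 _) (volume_coord_eq 1 _)

/-- Integrability on a set extends across a null set: if `f` is integrable on `S` and
`Ω ⊆ S ∪ N` with `N` null, then `f` is integrable on `Ω`. [folklore] -/
theorem integrableOn_of_subset_union_null {f : (Fin 3 → ℝ) → ℝ} {S N Ω : Set (Fin 3 → ℝ)}
    (hf : IntegrableOn f S) (hN : volume N = 0) (hΩ : Ω ⊆ S ∪ N) : IntegrableOn f Ω := by
  have hN' : IntegrableOn f N := by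
    rw [IntegrableOn, Measure.restrict_eq_zero.2 hN]
    exact integrable_zero_measure
  exact (hf.union hN').mono_set hΩ

/-! ## Measurability of the kernels -/

/-- The principal square root is Borel measurable (it is `w ↦ w ^ (1/2)`). [folklore] -/
theorem measurable_csqrt : Measurable Complex.sqrt := by
  have : Complex.sqrt = fun w : ℂ => w ^ (2⁻¹ : ℂ) := funext fun w => rfl
  rw [this]
  exact measurable_id.pow_const _

/-- `‖√w‖ = √‖w‖` for the principal square root. [folklore] -/
theorem norm_csqrt (w : ℂ) : ‖Complex.sqrt w‖ = Real.sqrt ‖w‖ := by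
  have h2 : (Complex.sqrt w) ^ 2 = w := by
    have h := Complex.cpow_nat_inv_pow w (n := 2) two_ne_zero
    simp only [Nat.cast_ofNat] at h
    exact h
  have hsq : ‖Complex.sqrt w‖ ^ 2 = ‖w‖ := by rw [← norm_pow, h2]
  rw [← hsq, Real.sqrt_sq (norm_nonneg _)]

/-- For real `x`, `‖Φ(x)‖ = √|∏(x − eⱼ)|` where `Φ(z) = ∏ⱼ √(z − eⱼ)`. [folklore] -/
theorem norm_Phi_real {e : Fin 5 → ℚ} {Φ : ℂ → ℂ}
    (hΦ : ∀ z, Φ z = ∏ j : Fin 5, Complex.sqrt (z - ((e j : ℝ) : ℂ))) (x : ℝ) :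
    ‖Φ (x : ℂ)‖ = Real.sqrt |∏ i : Fin 5, (x - (e i : ℝ))| := by
  rw [hΦ, norm_prod]
  have hterm : ∀ j : Fin 5, ‖Complex.sqrt ((x : ℂ) - ((e j : ℝ) : ℂ))‖ = Real.sqrt |x - (e j : ℝ)| := by
    intro j
    rw [norm_csqrt, ← Complex.ofReal_sub, Complex.norm_real, Real.norm_eq_abs]
  simp_rw [hterm]
  rw [Finset.abs_prod]
  have hnn : ∀ j ∈ (Finset.univ : Finset (Fin 5)), 0 ≤ |x - (e j : ℝ)| := fun j _ => abs_nonneg _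
  have hprod_nn : 0 ≤ ∏ j : Fin 5, Real.sqrt |x - (e j : ℝ)| :=
    Finset.prod_nonneg fun j _ => Real.sqrt_nonneg _
  rw [eq_comm, Real.sqrt_eq_iff_mul_self_eq (Finset.prod_nonneg hnn) hprod_nn, ← Finset.prod_mul_distrib]
  exact Finset.prod_congr rfl fun j _ => (Real.mul_self_sqrt (abs_nonneg _)).symm

end KernelIntegrable

open KernelIntegrable

/-! ## The pointwise bound on the simplex bulk kernel (auxiliary registered stub) -/

/-- **Auxiliary stub `stub_kernelIntegrableAux`: domination of `K′`.** From the four kernel bounds of `stub_bounds` (hypothesis `hbd`), for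
`x₀, x₁` off the branch points and `s > 0`,
`‖K′(x₀,x₁,s)‖ ≤ (3/2) C² m(x₀) m(x₁) (1 + s^{−3/4})(1+s²)^{−5/4}`, by the splitting
`K′ = [(1 − z₁S₁/2)/Φ₁]·Φ₀⁻¹ − [z₁/Φ₁]·[Φ₀⁻¹S₀]/2`. [folklore] -/
theorem stub_kernelIntegrableAux :
    ∀ (e : Fin 5 → ℚ) (Φ : ℂ → ℂ) (m : ℝ → ℝ) (C : ℝ),
    (∀ (x s : ℝ), 0 ≤ s → (∀ j, x ≠ (e j : ℝ)) →
        ‖(Φ ((x : ℂ) + (s : ℂ) * Complex.I))⁻¹‖ ≤ C * m x * (1 + s ^ 2) ^ (-(5:ℝ) / 8) ∧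
        ‖((x : ℂ) + (s : ℂ) * Complex.I) / Φ ((x : ℂ) + (s : ℂ) * Complex.I)‖ ≤
          C * m x * (1 + s ^ 2) ^ (-(1:ℝ) / 8) ∧
        (0 < s →
          ‖(Φ ((x : ℂ) + (s : ℂ) * Complex.I))⁻¹ *
              ∑ j : Fin 5, ((x : ℂ) + (s : ℂ) * Complex.I - ((e j : ℝ) : ℂ))⁻¹‖ ≤
            C * m x * (1 + s ^ (-(3:ℝ) / 4)) * (1 + s ^ 2) ^ (-(9:ℝ) / 8) ∧
          ‖(1 - ((x : ℂ) + (s : ℂ) * Complex.I) / 2 *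
                ∑ j : Fin 5, ((x : ℂ) + (s : ℂ) * Complex.I - ((e j : ℝ) : ℂ))⁻¹) /
              Φ ((x : ℂ) + (s : ℂ) * Complex.I)‖ ≤
            C * m x * (1 + s ^ (-(3:ℝ) / 4)) * (1 + s ^ 2) ^ (-(5:ℝ) / 8))) →
    ∀ (x₀ x₁ s : ℝ), 0 < s → (∀ j, x₀ ≠ (e j : ℝ)) → (∀ j, x₁ ≠ (e j : ℝ)) →
    ‖(1 - ((x₁ : ℂ) + (s : ℂ) * Complex.I) / 2 *
          ∑ j : Fin 5, (((x₀ : ℂ) + (s : ℂ) * Complex.I - ((e j : ℝ) : ℂ))⁻¹ +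
            ((x₁ : ℂ) + (s : ℂ) * Complex.I - ((e j : ℝ) : ℂ))⁻¹)) /
        (Φ ((x₀ : ℂ) + (s : ℂ) * Complex.I) * Φ ((x₁ : ℂ) + (s : ℂ) * Complex.I))‖ ≤
      3 / 2 * C ^ 2 * m x₀ * m x₁ * ((1 + s ^ (-(3:ℝ) / 4)) * (1 + s ^ 2) ^ (-(5:ℝ) / 4)) := by
  intro e Φ m C hbd x₀ x₁ s hs hx₀ hx₁
  -- abbreviations
  set z₀ : ℂ := (x₀ : ℂ) + (s : ℂ) * Complex.I with hz₀
  set z₁ : ℂ := (x₁ : ℂ) + (s : ℂ) * Complex.I with hz₁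
  set S₀ : ℂ := ∑ j : Fin 5, (z₀ - ((e j : ℝ) : ℂ))⁻¹ with hS₀
  set S₁ : ℂ := ∑ j : Fin 5, (z₁ - ((e j : ℝ) : ℂ))⁻¹ with hS₁
  obtain ⟨hB0, -, hB0'⟩ := hbd x₀ s hs.le hx₀
  obtain ⟨-, hB1, hB1'⟩ := hbd x₁ s hs.le hx₁
  obtain ⟨hB0', -⟩ := hB0' hs
  obtain ⟨-, hB1'⟩ := hB1' hs
  -- the splitting
  have hsplit : (1 - z₁ / 2 * ∑ j : Fin 5, ((z₀ - ((e j : ℝ) : ℂ))⁻¹ + (z₁ - ((e j : ℝ) : ℂ))⁻¹)) /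
        (Φ z₀ * Φ z₁) =
      (1 - z₁ / 2 * S₁) / Φ z₁ * (Φ z₀)⁻¹ - z₁ / Φ z₁ * ((Φ z₀)⁻¹ * S₀) / 2 := by
    rw [Finset.sum_add_distrib, ← hS₀, ← hS₁]
    simp only [div_eq_mul_inv, mul_inv]
    ring
  rw [hsplit]
  -- nonnegativity of the pieces
  have hn1 : 0 ≤ ‖(Φ z₀)⁻¹‖ := norm_nonneg _
  have hn2 : 0 ≤ ‖(Φ z₀)⁻¹ * S₀‖ := norm_nonneg _
  have hA : ‖(1 - z₁ / 2 * S₁) / Φ z₁ * (Φ z₀)⁻¹‖ ≤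
      (C * m x₁ * (1 + s ^ (-(3:ℝ) / 4)) * (1 + s ^ 2) ^ (-(5:ℝ) / 8)) *
        (C * m x₀ * (1 + s ^ 2) ^ (-(5:ℝ) / 8)) := by
    rw [norm_mul]
    exact mul_le_mul hB1' hB0 hn1 (le_trans (norm_nonneg _) hB1')
  have hB : ‖z₁ / Φ z₁ * ((Φ z₀)⁻¹ * S₀) / 2‖ ≤
      (C * m x₁ * (1 + s ^ 2) ^ (-(1:ℝ) / 8)) *
        (C * m x₀ * (1 + s ^ (-(3:ℝ) / 4)) * (1 + s ^ 2) ^ (-(9:ℝ) / 8)) / 2 := by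
    rw [norm_div, norm_mul, Complex.norm_two]
    exact div_le_div_of_nonneg_right (mul_le_mul hB1 hB0' hn2 (le_trans (norm_nonneg _) hB1))
      zero_le_two
  have hpos : 0 < 1 + s ^ 2 := by positivity
  have hr1 : (1 + s ^ 2) ^ (-(5:ℝ) / 8) * (1 + s ^ 2) ^ (-(5:ℝ) / 8) = (1 + s ^ 2) ^ (-(5:ℝ) / 4) := by
    rw [← Real.rpow_add hpos]; norm_num
  have hr2 : (1 + s ^ 2) ^ (-(1:ℝ) / 8) * (1 + s ^ 2) ^ (-(9:ℝ) / 8) = (1 + s ^ 2) ^ (-(5:ℝ) / 4) := by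
    rw [← Real.rpow_add hpos]; norm_num
  calc ‖(1 - z₁ / 2 * S₁) / Φ z₁ * (Φ z₀)⁻¹ - z₁ / Φ z₁ * ((Φ z₀)⁻¹ * S₀) / 2‖
      ≤ ‖(1 - z₁ / 2 * S₁) / Φ z₁ * (Φ z₀)⁻¹‖ + ‖z₁ / Φ z₁ * ((Φ z₀)⁻¹ * S₀) / 2‖ :=
        norm_sub_le _ _
    _ ≤ (C * m x₁ * (1 + s ^ (-(3:ℝ) / 4)) * (1 + s ^ 2) ^ (-(5:ℝ) / 8)) *
          (C * m x₀ * (1 + s ^ 2) ^ (-(5:ℝ) / 8)) +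
        (C * m x₁ * (1 + s ^ 2) ^ (-(1:ℝ) / 8)) *
          (C * m x₀ * (1 + s ^ (-(3:ℝ) / 4)) * (1 + s ^ 2) ^ (-(9:ℝ) / 8)) / 2 := add_le_add hA hB
    _ = C ^ 2 * m x₀ * m x₁ * (1 + s ^ (-(3:ℝ) / 4)) *
            ((1 + s ^ 2) ^ (-(5:ℝ) / 8) * (1 + s ^ 2) ^ (-(5:ℝ) / 8)) +
          C ^ 2 * m x₀ * m x₁ * (1 + s ^ (-(3:ℝ) / 4)) *
            ((1 + s ^ 2) ^ (-(1:ℝ) / 8) * (1 + s ^ 2) ^ (-(9:ℝ) / 8)) / 2 := by ring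
    _ = 3 / 2 * C ^ 2 * m x₀ * m x₁ * ((1 + s ^ (-(3:ℝ) / 4)) * (1 + s ^ 2) ^ (-(5:ℝ) / 4)) := by
        rw [hr1, hr2]; ring

end Summit.KontsevichZagierPeriods.UnfoldedStokes.HyperellipticRiemannRelationLine
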